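import Literature.Topology.FourManifolds.RegularIntervalBoundary
import HarnessLib

/-!
# The regular interval theorem with a prescribed profile: how `M ≅ Mᶜ` moves the levels near
# the boundary

Topic `Literature/Topology/FourManifolds` (fact seat
`provefact-Literature.Topology.FourManifolds.IsHandlebody.exists_isBoundaryGluing_sphere`, step F2b of
the Lickorish–Wallace DAG; infrastructure for the classification of handlebodies
`IsHandlebody.nonempty_diffeomorph`, whose induction carries the invariant "the diffeomorphism
is level preserving near the top boundary": two manifolds are pushed into their sublevel sets
*with the same profile*, so that a level-preserving comparison of the sublevel sets pulls back to
a level-preserving comparison of the manifolds).  Everything here is **proved**; no named facts.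

`RegularIntervalBoundary.lean` proves `M ≅ Mᶜ = {f ≤ c}` (Milnor, *Morse theory* (1963),
Thm. 3.1, for compact manifolds with boundary) as `Φ⁻¹ ∘ push`; the push moves a point at depth
`s = 1 - f` to depth `σ(s)` and `Φ⁻¹` lowers `f` by `(1 - κ) - c`, where `κ = c₀ a₀/2`,
`σ = σ_{a₀}` depend only on the height `a₀` of the cover used.  Here this is recorded:

* `Literature.Topology.FourManifolds.pushDepthOf a₀ = c₀ a₀ / 2`,
  `Literature.Topology.FourManifolds.pushShiftOf a₀ s = (a₀/2) h(2s/a₀)` — the depth and level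
  shift of the push as functions of the height alone (`Cover.pushDepth_eq_pushDepthOf`,
  `Cover.pushShift_eq_pushShiftOf`).
* `Literature.Topology.FourManifolds.exists_diffeomorph_sublevel_apply_eq` — for every
  sufficiently small height `a₀ > 0` there is a diffeomorphism `G : M ≅ Mᶜ` with
  `f (G x) = c + κ(a₀) - σ_{a₀}(1 - f x)` for all `x` near `∂M` (`1 - f x < s₀`).  Two
  manifolds treated with the same `a₀` (take the smaller of the two bounds) and the same `c`
  thus get the *same* level map near their boundaries.

## References

* J. Milnor, *Morse theory*, Ann. of Math. Studies 51 (1963), Thm. 3.1. [Milnor1963]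
* J. Milnor, *Lectures on the h-cobordism theorem* (1965), Def. 3.1, Lemma 2.9.
  [MilnorHCobordism1965]
-/

open scoped Manifold ContDiff Topology
open Set Function Filter

noncomputable section

namespace Literature.Topology.FourManifolds

/-! ### The profile of the push as a function of the height -/

section Profile

/-- The depth `κ(a₀) = c₀ a₀ / 2` to which a cover of height `a₀` pushes the boundary.
[folklore] -/
def pushDepthOf (a₀ : ℝ) : ℝ := pushConst * (a₀ / 2)

/-- The level shift `σ_{a₀}(s) = (a₀/2) · h(s / (a₀/2))` of the push of a cover of height
`a₀` (`h` the push profile). [folklore] -/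
def pushShiftOf (a₀ s : ℝ) : ℝ := a₀ / 2 * pushProfile (s / (a₀ / 2))

/-- `κ(a₀) > 0` for `a₀ > 0`. [folklore] -/
theorem pushDepthOf_pos {a₀ : ℝ} (h : 0 < a₀) : 0 < pushDepthOf a₀ :=
  mul_pos pushConst_pos (by linarith)

/-- `κ(a₀) ≤ a₀ / 2`. [folklore] -/
theorem pushDepthOf_le {a₀ : ℝ} (h : 0 ≤ a₀) : pushDepthOf a₀ ≤ a₀ / 2 := by
  unfold pushDepthOf
  have := pushConst_le_one
  have := pushConst_pos
  nlinarith

/-- `σ_{a₀}(0) = κ(a₀)`. [folklore] -/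
theorem pushShiftOf_zero (a₀ : ℝ) : pushShiftOf a₀ 0 = pushDepthOf a₀ := by
  unfold pushShiftOf pushDepthOf
  rw [zero_div, pushProfile_of_nonpos le_rfl, zero_add, mul_comm]

/-- `σ_{a₀}` is strictly increasing (for `a₀ > 0`). [folklore] -/
theorem strictMono_pushShiftOf {a₀ : ℝ} (h : 0 < a₀) : StrictMono (pushShiftOf a₀) := fun _ _ hst =>
  mul_lt_mul_of_pos_left (strictMono_pushProfile (div_lt_div_of_pos_right hst (by linarith)))
    (by linarith)

/-- `σ_{a₀}(s) ≤ s + κ(a₀)` (for `a₀ > 0`). [folklore] -/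
theorem pushShiftOf_le {a₀ : ℝ} (h : 0 < a₀) (s : ℝ) : pushShiftOf a₀ s ≤ s + pushDepthOf a₀ := by
  unfold pushShiftOf pushDepthOf
  have h1 := pushProfile_le (s / (a₀ / 2))
  have h2 : 0 < a₀ / 2 := by linarith
  calc a₀ / 2 * pushProfile (s / (a₀ / 2)) ≤ a₀ / 2 * (s / (a₀ / 2) + pushConst) :=
        mul_le_mul_of_nonneg_left h1 h2.le
    _ = s + pushConst * (a₀ / 2) := by field_simp

namespace FlowoutInput.Cover

variable {k : ℕ} {M : Type*} [TopologicalSpace M] [ChartedSpace (EuclideanHalfSpace (k + 1)) M]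
  [IsManifold (𝓡∂ (k + 1)) ∞ M] {D : FlowoutInput k M} (Γ : D.Cover)

/-- The push depth of a cover is `κ` of its height. [folklore] -/
theorem pushDepth_eq_pushDepthOf : Γ.pushDepth = pushDepthOf Γ.a := rfl

/-- The level shift of a cover is `σ` of its height. [folklore] -/
theorem pushShift_eq_pushShiftOf (s : ℝ) : Γ.pushShift s = pushShiftOf Γ.a s := rfl

end FlowoutInput.Cover

end Profile

/-! ### `M ≅ Mᶜ` with a prescribed profile -/

section Levels

universe u

variable {k : ℕ} {M : Type u} [TopologicalSpace M] [T2Space M] [CompactSpace M]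
  [ChartedSpace (EuclideanHalfSpace (k + 1)) M] [IsManifold (𝓡∂ (k + 1)) ∞ M]

/-- **The regular interval theorem with a prescribed profile.**  In the situation of
`Literature.Topology.FourManifolds.nonempty_diffeomorph_sublevel_of_forall_le_mfderiv_ne_zero`
(`f` smooth on the compact manifold with boundary `M` of dimension `k + 1 ≥ 2`, `f = 1` on `∂M`,
`f < 1` inside, `df ≠ 0` wherever `c ≤ f`, `c < 1`) there is `a_max > 0` such that for every
height `a₀ ∈ (0, a_max]` there are a diffeomorphism `G : M ≅ Mᶜ` and `s₀ > 0` with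
`f (G x) = c + κ(a₀) - σ_{a₀}(1 - f x)` whenever `1 - f x < s₀` — the levels near `∂M` are moved
by a map depending only on `(c, a₀)` (`G = Φ⁻¹ ∘ push` for a cover of height exactly `a₀`;
the push sends depth `s` to depth `σ_{a₀}(s)` and `Φ⁻¹` lowers `f` by `(1 - κ(a₀)) - c`).
[cite: Milnor1963, Thm. 3.1] [cite: MilnorHCobordism1965, Lemma 2.9 and proof of Thm. 3.4] -/
theorem exists_diffeomorph_sublevel_apply_eq (hk : 1 ≤ k) {f : M → ℝ}
    (hf : ContMDiff (𝓡∂ (k + 1)) 𝓘(ℝ, ℝ) ∞ f)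
    (hbd : ∀ x ∈ (𝓡∂ (k + 1)).boundary M, f x = 1)
    (hlt : ∀ x ∈ (𝓡∂ (k + 1)).interior M, f x < 1) {c : ℝ} (hc : c < 1)
    (hreg : ∀ x, c ≤ f x → mfderiv (𝓡∂ (k + 1)) 𝓘(ℝ, ℝ) f x ≠ 0)
    (hint : ∀ p, f p ≤ c → (𝓡∂ (k + 1)).IsInteriorPoint p)
    (hreg' : ∀ p, f p = c → ¬ IsMCriticalPt (𝓡∂ (k + 1)) f p) :
    letI := (sublevelAtlas hf c hint hreg').chartedSpace
    ∃ amax : ℝ, 0 < amax ∧ ∀ a₀ : ℝ, 0 < a₀ → a₀ ≤ amax →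
      ∃ (G : M ≃ₘ⟮𝓡∂ (k + 1), 𝓡∂ (k + 1)⟯ ↥(f ⁻¹' Iic c)) (s₀ : ℝ), 0 < s₀ ∧
        ∀ x, 1 - f x < s₀ → f (G x).1 = c + pushDepthOf a₀ - pushShiftOf a₀ (1 - f x) := by
  set A := sublevelAtlas hf c hint hreg' with hA
  letI := A.chartedSpace
  haveI := A.isManifold
  obtain ⟨D, hDf, hDδ⟩ := exists_flowoutInput_of_boundary hf hbd hlt hc hreg
  obtain ⟨Γ₀⟩ := D.nonempty_cover
  have hfD : ∀ z, D.f z = 1 - f z := fun z => by rw [hDf]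
  refine ⟨min Γ₀.a (1 - c), lt_min Γ₀.a_pos (by linarith), fun a₀ ha₀ ha₀le => ?_⟩
  set Γ := Γ₀.withHeight a₀ ha₀ (ha₀le.trans (min_le_left _ _)) with hΓ
  have hΓa : Γ.a = a₀ := rfl
  set κ := Γ.pushDepth with hκ
  have hκeq : κ = pushDepthOf a₀ := rfl
  have hσeq : ∀ s, Γ.pushShift s = pushShiftOf a₀ s := fun s => rfl
  have hκpos : 0 < κ := Γ.pushDepth_pos
  have hκle : κ < 1 - c := by
    have h1 : κ ≤ a₀ / 2 := pushDepthOf_le ha₀.le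
    have h3 : a₀ ≤ 1 - c := ha₀le.trans (min_le_right _ _)
    linarith
  have hrange : range Γ.push = {w | f w ≤ 1 - κ} := by
    rw [Γ.range_push]
    ext w
    simp only [mem_setOf_eq, hfD]
    constructor <;> intro h <;> linarith
  -- the ambient diffeomorphism, with its level bookkeeping
  have hcb : c ≤ 1 - κ := by linarith
  have hregs : ∀ x, f x ∈ Icc c (1 - κ) → mfderiv (𝓡∂ (k + 1)) 𝓘(ℝ, ℝ) f x ≠ 0 :=
    fun x hx => hreg x hx.1
  have hints : ∀ x, f x ∈ Icc c (1 - κ) → (𝓡∂ (k + 1)).IsInteriorPoint x := fun x hx =>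
    ((𝓡∂ (k + 1)).isInteriorPoint_or_isBoundaryPoint x).resolve_right fun hb => by
      have := hbd x hb; linarith [hx.2]
  obtain ⟨δ, Φ, hδ, hΦ, -, -, hlevel, -, hle⟩ :=
    exists_diffeomorph_image_sublevel_eq_of_isInteriorPoint' hf hcb hregs hints
  have hmem : ∀ z, Φ.symm (Γ.push z) ∈ f ⁻¹' Iic c := by
    intro z
    have h1 : Γ.push z ∈ Φ '' {x | f x ≤ c} := by
      rw [hΦ, ← hrange]; exact mem_range_self z
    obtain ⟨x, hx, hxe⟩ := h1
    rw [← hxe, Diffeomorph.symm_apply_apply]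
    exact hx
  have hmem' : ∀ w : ↥(f ⁻¹' Iic c), Φ w.1 ∈ {w | Γ.pushDepth ≤ D.f w} := by
    intro w
    have h1 : Φ w.1 ∈ Φ '' {x | f x ≤ c} := mem_image_of_mem _ w.2
    rw [hΦ] at h1
    show Γ.pushDepth ≤ D.f (Φ w.1)
    rw [hfD]
    simp only [mem_setOf_eq] at h1
    linarith
  have hto : ContMDiff (𝓡∂ (k + 1)) (𝓡∂ (k + 1)) ∞
      ((f ⁻¹' Iic c).codRestrict (fun z => Φ.symm (Γ.push z)) hmem) :=
    A.contMDiff_codRestrict hmem (Φ.symm.contMDiff.comp Γ.contMDiff_push)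
  have hinv : ContMDiff (𝓡∂ (k + 1)) (𝓡∂ (k + 1)) ∞
      (fun w : ↥(f ⁻¹' Iic c) => Γ.pull (Φ w.1)) :=
    Γ.contMDiffOn_pull.comp_contMDiff (Φ.contMDiff.comp (A.contMDiff_subtype_val hk)) hmem'
  set G : M ≃ₘ⟮𝓡∂ (k + 1), 𝓡∂ (k + 1)⟯ ↥(f ⁻¹' Iic c) :=
    { toFun := (f ⁻¹' Iic c).codRestrict (fun z => Φ.symm (Γ.push z)) hmem
      invFun := fun w => Γ.pull (Φ w.1)
      left_inv := fun z => by
        show Γ.pull (Φ (Φ.symm (Γ.push z))) = z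
        rw [Diffeomorph.apply_symm_apply, Γ.pull_push]
      right_inv := fun w => by
        apply Subtype.ext
        show Φ.symm (Γ.push (Γ.pull (Φ w.1))) = w.1
        rw [Γ.push_pull (hmem' w), Diffeomorph.symm_apply_apply]
      contMDiff_toFun := hto
      contMDiff_invFun := hinv } with hG
  refine ⟨G, δ, hδ, fun x hx => ?_⟩
  -- the level of `G x = Φ⁻¹ (push x)`
  show f (Φ.symm (Γ.push x)) = c + pushDepthOf a₀ - pushShiftOf a₀ (1 - f x)
  set s := 1 - f x with hs
  set y := Φ.symm (Γ.push x) with hy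
  have hpush : f (Γ.push x) = 1 - Γ.pushShift s := by
    have h := Γ.f_push x
    rw [hfD, hfD] at h
    linarith
  have hΦy : Φ y = Γ.push x := by rw [hy, Diffeomorph.apply_symm_apply]
  have hσle : Γ.pushShift s ≤ s + κ := Γ.pushShift_le s
  have hyc : f y ≤ c := hmem x
  -- speed at most one: `f (push x) ≤ f y + ((1 - κ) - c)`
  have hlow : c + κ - Γ.pushShift s ≤ f y := by
    have h := hle y
    rw [hΦy, hpush] at h
    linarith
  have hband : f y ∈ Ioo (c - δ) (c + δ) := ⟨by linarith, by linarith⟩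
  have h := hlevel y hband
  rw [hΦy, hpush] at h
  rw [← hκeq, ← hσeq]
  linarith

end Levels

end Literature.Topology.FourManifolds
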